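import Literature.Barriers.QuantumFields.FreeTwoPointContinuation
import Literature.Barriers.QuantumFields.HaagTheoremContinuationProofs
import Literature.MathematicalPhysics.QuantumLattice.FreeCovarianceProofs
import Mathlib.MeasureTheory.Integral.Pi
import Mathlib.MeasureTheory.Integral.DominatedConvergence
import HarnessLib

/-!
# Boundary values of the free holomorphic two-point function on tensor test functions

Sibling proof file of `FreeTwoPointContinuation.lean` (theorems only). Along the rays
`x + itη`, `η` in the base cone of the forward tube, `t → 0⁺`, the free holomorphic two-point
function integrated against a tensor test function `F(x₀) G(x₁)` tends to the free two-point
function `freeTwoPoint d m F G` of `JostSchroerSteps`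
(`tendsto_integral_freeTwoPointWightmanHol_tensor`):

* at `t > 0` the configuration integral is computed in closed form
  (`integral_freeTwoPointWightmanHol_ray_tensor`):
  `∫ 𝔚(x + itη) F(x₀) G(x₁) dx = ∫ (4πE)⁻¹ e^{−2πt⟪q, η₁ − η₀⟫} 𝓕F(q) 𝓕G(−q) dξ⃗`, `q = (E_m(ξ⃗), ξ⃗)`
  (expand `𝔚`, Fubini — the integrand is bounded by `(2|m|)⁻¹ e^{−2πtδ‖ξ⃗‖} |F(x₀)| |G(x₁)|` with
  `δ = (η₁ − η₀)⁰ − ‖(η₁ − η₀)⃗‖ > 0` —, factorise, and recognise the two Fourier transforms);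
* `t → 0⁺` by dominated convergence (Schwartz decay of `𝓕F` on the mass shell).

This is the statement that the Wightman two-point *distribution* of the free field, paired with
`F ⊗ G`, is `freeTwoPoint d m F G` (Streater–Wightman Thm 3-5: "`W(ξ) = lim_{η→0} W(ξ − iη)` …
in `𝒮'`", for the free field, on tensors).

## References

* R. F. Streater, A. S. Wightman, *PCT, Spin and Statistics, and All That*, §3-3 Thm 3-5 (pdf
  p. 100), §3-2 (free two-point function, pdf p. 102). [StreaterWightman2001]
-/

noncomputable section

open MeasureTheory Complex Real Filter Topology
open scoped InnerProductSpace SchwartzMap FourierTransform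

namespace Literature.Barriers.QuantumFields

open Literature.MathematicalPhysics.QuantumLattice

variable {d : ℕ}

/-! ### The exponent along a ray -/

/-- `E_m(ξ⃗) y⁰ + ξ⃗·y⃗ = ⟪(E_m(ξ⃗), ξ⃗), y⟫` at a real point `y`. [folklore] -/
theorem shellEnergy_mul_add_spatialPairC_complexifyPoint (m : ℝ) (ξ : EuclideanSpace ℝ (Fin d))
    (y : SpaceTime d) :
    (shellEnergy d m ξ : ℂ) * complexifyPoint y 0 + spatialPairC d ξ (complexifyPoint y) =
      (⟪shellPoint d m ξ, y⟫_ℝ : ℂ) := by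
  rw [spatialPairC_complexifyPoint, complexifyPoint_apply, shellPoint, PiLp.inner_apply,
    PiLp.inner_apply, Fin.sum_univ_succ]
  simp only [ofTimeSpace_apply_zero, ofTimeSpace_apply_succ, spaceC_apply, RCLike.inner_apply,
    conj_trivial]
  push_cast
  ring

/-- The difference variable along the ray `x + itη`: `E ζ⁰ + ξ⃗·ζ⃗ = ⟪q, x₁ − x₀⟫ + it⟪q, η₁ − η₀⟫`,
`q = (E_m(ξ⃗), ξ⃗)`. [folklore] -/
theorem exponent_ray (m : ℝ) (ξ : EuclideanSpace ℝ (Fin d)) (x η : Fin 2 → SpaceTime d) (t : ℝ) :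
    (shellEnergy d m ξ : ℂ) *
        ((fun k => complexifyPoint (x k) + ((t : ℂ) * I) • complexifyPoint (η k)) 1 -
          (fun k => complexifyPoint (x k) + ((t : ℂ) * I) • complexifyPoint (η k)) 0) 0 +
      spatialPairC d ξ
        ((fun k => complexifyPoint (x k) + ((t : ℂ) * I) • complexifyPoint (η k)) 1 -
          (fun k => complexifyPoint (x k) + ((t : ℂ) * I) • complexifyPoint (η k)) 0) =
      (⟪shellPoint d m ξ, x 1 - x 0⟫_ℝ : ℂ) + (t : ℂ) * I * (⟪shellPoint d m ξ, η 1 - η 0⟫_ℝ : ℂ) := by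
  have hζ : (fun k => complexifyPoint (x k) + ((t : ℂ) * I) • complexifyPoint (η k)) 1 -
      (fun k => complexifyPoint (x k) + ((t : ℂ) * I) • complexifyPoint (η k)) 0 =
      complexifyPoint (x 1 - x 0) + ((t : ℂ) * I) • complexifyPoint (η 1 - η 0) := by
    funext μ
    simp only [Pi.sub_apply, Pi.add_apply, Pi.smul_apply, smul_eq_mul, complexifyPoint_apply,
      PiLp.sub_apply]
    push_cast
    ring
  rw [hζ, spatialPairC_add, spatialPairC_smul, Pi.add_apply, Pi.smul_apply, smul_eq_mul, mul_add,
    ← shellEnergy_mul_add_spatialPairC_complexifyPoint m ξ (x 1 - x 0),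
    ← shellEnergy_mul_add_spatialPairC_complexifyPoint m ξ (η 1 - η 0)]
  ring

/-- The margin of a base-cone direction: `δ = (η₁ − η₀)⁰ − ‖(η₁ − η₀)⃗‖ > 0`, and
`⟪q, η₁ − η₀⟫ ≥ δ ‖ξ⃗‖ ≥ 0`. [folklore] -/
theorem inner_shellPoint_ge {η : Fin 2 → SpaceTime d} (hη : η ∈ tubeCone d 2) (m : ℝ)
    (ξ : EuclideanSpace ℝ (Fin d)) :
    ((η 1 - η 0) 0 - ‖spaceC d (η 1 - η 0)‖) * ‖ξ‖ ≤ ⟪shellPoint d m ξ, η 1 - η 0⟫_ℝ ∧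
      0 < (η 1 - η 0) 0 - ‖spaceC d (η 1 - η 0)‖ := by
  have hV : η 1 - η 0 ∈ forwardCone d := by
    have := hη 1
    rwa [show (1 : Fin 2) = (0 : Fin 1).succ from rfl, succDiff_succ] at this
  have hlt := (mem_forwardCone_iff_norm_lt (η 1 - η 0)).1 hV
  refine ⟨?_, by linarith⟩
  -- transport `shellEnergy_mul_add_sum_ge` (stated for complex points) to the real vector
  have h0im : (((I : ℂ) • complexifyPoint (η 1 - η 0)) 0).im = (η 1 - η 0) 0 := by simp
  have h := shellEnergy_mul_add_sum_ge m ξ ((I : ℂ) • complexifyPoint (η 1 - η 0))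
    (by rw [h0im]; exact (norm_nonneg _).trans hlt.le)
  have him : imPart ((I : ℂ) • complexifyPoint (η 1 - η 0)) = η 1 - η 0 := by
    ext μ; simp
  have hsucc : ∀ i : Fin d, (((I : ℂ) • complexifyPoint (η 1 - η 0)) i.succ).im = (η 1 - η 0) i.succ :=
    fun i => by simp
  simp only [h0im, hsucc, him] at h
  have hinner : ⟪shellPoint d m ξ, η 1 - η 0⟫_ℝ =
      shellEnergy d m ξ * (η 1 - η 0) 0 + ∑ i : Fin d, ξ i * (η 1 - η 0) i.succ := by
    rw [shellPoint, PiLp.inner_apply, Fin.sum_univ_succ]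
    simp only [ofTimeSpace_apply_zero, ofTimeSpace_apply_succ, RCLike.inner_apply, conj_trivial]
    congr 1
    · ring
    · exact Finset.sum_congr rfl fun i _ => by ring
  rw [hinner]
  exact h

/-! ### The integral along a ray, in closed form -/

/-- **The free holomorphic two-point function along a ray, integrated against a tensor**
(`t > 0`): `∫ 𝔚(x + itη) F(x₀) G(x₁) dx = ∫ (4πE)⁻¹ e^{−2πt⟪q, η₁−η₀⟫} 𝓕F(q) 𝓕G(−q) dξ⃗`.
[cite: StreaterWightman2001, §3-3 Thm 3-5] -/
theorem integral_freeTwoPointWightmanHol_ray_tensor {m : ℝ} (hm : m ≠ 0)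
    (F G : 𝓢(SpaceTime d, ℂ)) {η : Fin 2 → SpaceTime d} (hη : η ∈ tubeCone d 2) {t : ℝ}
    (ht : 0 < t) :
    ∫ x : Fin 2 → SpaceTime d,
        freeTwoPointWightmanHol d m
            (fun k => complexifyPoint (x k) + ((t : ℂ) * I) • complexifyPoint (η k)) *
          (F (x 0) * G (x 1)) =
      ∫ ξ : EuclideanSpace ℝ (Fin d), ((4 * π * shellEnergy d m ξ)⁻¹ : ℝ) •
        ((rexp (-(2 * π * t * ⟪shellPoint d m ξ, η 1 - η 0⟫_ℝ)) : ℂ) *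
          ((𝓕 F : 𝓢(SpaceTime d, ℂ)) (shellPoint d m ξ) *
            (𝓕 G : 𝓢(SpaceTime d, ℂ)) (-shellPoint d m ξ))) := by
  obtain ⟨-, hδ⟩ := inner_shellPoint_ge hη m (0 : EuclideanSpace ℝ (Fin d))
  set δ : ℝ := (η 1 - η 0) 0 - ‖spaceC d (η 1 - η 0)‖ with hδdef
  -- the integrand, expanded
  set Φ : EuclideanSpace ℝ (Fin d) → (Fin 2 → SpaceTime d) → ℂ := fun ξ x =>
    ((4 * π * shellEnergy d m ξ)⁻¹ : ℝ) •
      ((rexp (-(2 * π * t * ⟪shellPoint d m ξ, η 1 - η 0⟫_ℝ)) : ℂ) *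
        (𝐞 (⟪shellPoint d m ξ, x 1 - x 0⟫_ℝ) : ℂ)) with hΦ
  have hexpand : ∀ x : Fin 2 → SpaceTime d,
      freeTwoPointWightmanHol d m
          (fun k => complexifyPoint (x k) + ((t : ℂ) * I) • complexifyPoint (η k)) =
        ∫ ξ, Φ ξ x := by
    intro x
    rw [freeTwoPointWightmanHol_apply, freeTwoPointHol]
    congr 1
    funext ξ
    rw [freeTwoPointHolIntegrand, exponent_ray, hΦ]
    simp only
    congr 1
    rw [mul_add, Complex.exp_add, Real.fourierChar_apply, Complex.ofReal_exp, mul_comm]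
    congr 1
    · congr 1
      push_cast
      ring_nf
      rw [Complex.I_sq]
      ring
    · congr 1
      push_cast
      ring
  have h1 : ∀ x : Fin 2 → SpaceTime d,
      freeTwoPointWightmanHol d m
            (fun k => complexifyPoint (x k) + ((t : ℂ) * I) • complexifyPoint (η k)) *
          (F (x 0) * G (x 1)) = ∫ ξ, Φ ξ x * (F (x 0) * G (x 1)) := by
    intro x
    rw [hexpand, ← integral_mul_const]
  simp_rw [h1]
  -- Fubini
  have hΦc : Continuous fun p : (Fin 2 → SpaceTime d) × EuclideanSpace ℝ (Fin d) =>
      Φ p.2 p.1 * (F (p.1 0) * G (p.1 1)) := by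
    have hE : Continuous fun p : (Fin 2 → SpaceTime d) × EuclideanSpace ℝ (Fin d) =>
        shellEnergy d m p.2 := (continuous_shellEnergy m).comp continuous_snd
    have hq : Continuous fun p : (Fin 2 → SpaceTime d) × EuclideanSpace ℝ (Fin d) =>
        shellPoint d m p.2 := by
      have : Continuous fun ξ : EuclideanSpace ℝ (Fin d) => shellPoint d m ξ := by
        unfold shellPoint
        exact continuous_ofTimeSpace_uncurry.comp
          ((continuous_shellEnergy m).prodMk continuous_id)
      exact this.comp continuous_snd
    have hEpos : ∀ p : (Fin 2 → SpaceTime d) × EuclideanSpace ℝ (Fin d),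
        4 * π * shellEnergy d m p.2 ≠ 0 := fun p =>
      (mul_pos (by positivity) (shellEnergy_pos d hm p.2)).ne'
    simp only [hΦ]
    refine ((((continuous_const.mul hE).inv₀ hEpos).smul ?_).mul (by fun_prop))
    refine (Complex.continuous_ofReal.comp (Real.continuous_exp.comp ?_)).mul ?_
    · exact (continuous_const.mul (hq.inner continuous_const)).neg
    · exact continuous_fourierChar_coe.comp (hq.inner (by fun_prop))
  have hbound : ∀ (x : Fin 2 → SpaceTime d) (ξ : EuclideanSpace ℝ (Fin d)),
      ‖Φ ξ x * (F (x 0) * G (x 1))‖ ≤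
        ((4 * π * (|m| / (2 * π)))⁻¹ * rexp (-(2 * π * t * δ * ‖ξ‖))) * (‖F (x 0)‖ * ‖G (x 1)‖) := by
    intro x ξ
    obtain ⟨hge, -⟩ := inner_shellPoint_ge hη m ξ
    have hE := shellEnergy_pos d hm ξ
    have hEm : |m| / (2 * π) ≤ shellEnergy d m ξ := by
      unfold shellEnergy
      calc |m| / (2 * π) = Real.sqrt ((m / (2 * π)) ^ 2) := by
            rw [Real.sqrt_sq_eq_abs, abs_div, abs_of_pos (by positivity : (0 : ℝ) < 2 * π)]
        _ ≤ Real.sqrt (‖ξ‖ ^ 2 + (m / (2 * π)) ^ 2) := Real.sqrt_le_sqrt (by nlinarith)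
    have hm' : 0 < |m| / (2 * π) := by positivity
    rw [norm_mul, norm_mul, hΦ]
    simp only
    rw [norm_smul, norm_mul, Circle.norm_coe, mul_one, Complex.norm_real,
      Real.norm_of_nonneg (Real.exp_pos _).le, Real.norm_of_nonneg (by positivity)]
    refine mul_le_mul_of_nonneg_right ?_ (by positivity)
    refine mul_le_mul ?_ ?_ (by positivity) (by positivity)
    · exact inv_anti₀ (by positivity) (by nlinarith [Real.pi_pos])
    · rw [← hδdef] at hge
      exact Real.exp_le_exp.2 (by nlinarith [mul_le_mul_of_nonneg_left hge ht.le, Real.pi_pos])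
  have hint : Integrable (fun p : (Fin 2 → SpaceTime d) × EuclideanSpace ℝ (Fin d) =>
      Φ p.2 p.1 * (F (p.1 0) * G (p.1 1))) (volume.prod volume) := by
    refine Integrable.mono' ?_ hΦc.aestronglyMeasurable (ae_of_all _ fun p => hbound p.1 p.2)
    have hx : Integrable fun x : Fin 2 → SpaceTime d => ‖F (x 0)‖ * ‖G (x 1)‖ := by
      have h := Integrable.fintype_prod (ι := Fin 2) (μ := fun _ => volume)
        (f := fun i => ((![F, G] : Fin 2 → 𝓢(SpaceTime d, ℂ)) i : SpaceTime d → ℂ)) fun i => by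
          fin_cases i <;> exact SchwartzMap.integrable _
      have h' : Integrable fun x : Fin 2 → SpaceTime d => F (x 0) * G (x 1) := by
        refine h.congr (ae_of_all _ fun x => ?_)
        simp only [Fin.prod_univ_two, Matrix.cons_val_zero, Matrix.cons_val_one]
      simpa only [norm_mul] using h'.norm
    have hξ : Integrable fun ξ : EuclideanSpace ℝ (Fin d) =>
        (4 * π * (|m| / (2 * π)))⁻¹ * rexp (-(2 * π * t * δ * ‖ξ‖)) := by
      have := (integrable_one_add_norm_pow_mul_exp_neg (d := d) (β := 2 * π * t * δ)
        (by positivity) 0).const_mul (4 * π * (|m| / (2 * π)))⁻¹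
      refine this.congr (ae_of_all _ fun ξ => ?_)
      simp only [pow_zero, one_mul]
    refine (hx.mul_prod hξ).congr (ae_of_all _ fun p => ?_)
    simp only
    ring
  rw [integral_integral_swap hint]
  congr 1
  funext ξ
  -- factorise the configuration integral and recognise the Fourier transforms
  set A : SpaceTime d → ℂ := fun v => (𝐞 (-⟪v, shellPoint d m ξ⟫_ℝ) : ℂ) * F v with hA
  set B : SpaceTime d → ℂ := fun v => (𝐞 (⟪v, shellPoint d m ξ⟫_ℝ) : ℂ) * G v with hB
  have hpt : ∀ x : Fin 2 → SpaceTime d, Φ ξ x * (F (x 0) * G (x 1)) =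
      (((4 * π * shellEnergy d m ξ)⁻¹ : ℝ) : ℂ) *
        (rexp (-(2 * π * t * ⟪shellPoint d m ξ, η 1 - η 0⟫_ℝ)) : ℂ) * (A (x 0) * B (x 1)) := by
    intro x
    simp only [hΦ, hA, hB, Complex.real_smul]
    rw [show ⟪shellPoint d m ξ, x 1 - x 0⟫_ℝ = ⟪x 1, shellPoint d m ξ⟫_ℝ + -⟪x 0, shellPoint d m ξ⟫_ℝ by
      rw [inner_sub_right, real_inner_comm (x 1), real_inner_comm (x 0), sub_eq_add_neg],
      fourierChar_coe_add]
    ring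
  simp_rw [hpt]
  rw [integral_const_mul]
  have hprod := integral_fintype_prod_volume_eq_prod (ι := Fin 2) (E := fun _ => SpaceTime d)
    (fun i => ((![A, B] : Fin 2 → SpaceTime d → ℂ)) i)
  simp only [Fin.prod_univ_two, Matrix.cons_val_zero, Matrix.cons_val_one] at hprod
  rw [hprod]
  have hFA : ∫ v, A v = (𝓕 F : 𝓢(SpaceTime d, ℂ)) (shellPoint d m ξ) := by
    rw [SchwartzMap.fourier_coe, Real.fourier_eq]
    simp only [hA, Circle.smul_def, smul_eq_mul]
  have hFB : ∫ v, B v = (𝓕 G : 𝓢(SpaceTime d, ℂ)) (-shellPoint d m ξ) := by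
    rw [SchwartzMap.fourier_coe, Real.fourier_eq]
    simp only [hB, Circle.smul_def, smul_eq_mul, inner_neg_right, neg_neg]
  rw [hFA, hFB, Complex.real_smul]
  ring

/-! ### The limit `t → 0⁺` -/

/-- A Schwartz function is bounded by a multiple of the inverse Japanese bracket:
`‖f x‖ ≤ C (1 + ‖x‖)^{−k}`. [folklore] -/
theorem SchwartzMap.exists_norm_le_one_add_pow_neg {V : Type*} [NormedAddCommGroup V]
    [NormedSpace ℝ V] (f : 𝓢(V, ℂ)) (k : ℕ) :
    ∃ C : ℝ, 0 ≤ C ∧ ∀ x : V, ‖f x‖ ≤ C * (1 + ‖x‖) ^ (-(k : ℝ)) := by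
  set C : ℝ := 2 ^ k * ((Finset.Iic (k, 0)).sup fun m => SchwartzMap.seminorm ℂ m.1 m.2) f with hC
  refine ⟨C, by positivity, fun x => ?_⟩
  have h := SchwartzMap.one_add_le_sup_seminorm_apply (𝕜 := ℂ) (m := (k, 0)) (k := k) (n := 0)
    le_rfl le_rfl f x
  rw [norm_iteratedFDeriv_zero] at h
  have hpos : 0 < (1 + ‖x‖) ^ k := by positivity
  rw [Real.rpow_neg (by positivity), Real.rpow_natCast, ← div_eq_mul_inv, le_div_iff₀ hpos]
  calc ‖f x‖ * (1 + ‖x‖) ^ k = (1 + ‖x‖) ^ k * ‖f x‖ := mul_comm _ _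
    _ ≤ C := h

/-- **Boundary value of the free holomorphic two-point function on tensor test functions**:
`lim_{t→0⁺} ∫ 𝔚(x + itη) F(x₀) G(x₁) dx = freeTwoPoint d m F G` for every direction `η` in the
base cone of the forward tube (Streater–Wightman Thm 3-5 for the free field, two-point function,
on tensors). [cite: StreaterWightman2001, §3-3 Thm 3-5 with §3-2] -/
theorem tendsto_integral_freeTwoPointWightmanHol_tensor {m : ℝ} (hm : m ≠ 0)
    (F G : 𝓢(SpaceTime d, ℂ)) {η : Fin 2 → SpaceTime d} (hη : η ∈ tubeCone d 2) :
    Tendsto (fun t : ℝ => ∫ x : Fin 2 → SpaceTime d,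
        freeTwoPointWightmanHol d m
            (fun k => complexifyPoint (x k) + ((t : ℂ) * I) • complexifyPoint (η k)) *
          (F (x 0) * G (x 1)))
      (𝓝[>] 0) (𝓝 (freeTwoPoint d m F G)) := by
  -- replace the configuration integral by its closed form for `t > 0`
  set Ψ : ℝ → EuclideanSpace ℝ (Fin d) → ℂ := fun t ξ => ((4 * π * shellEnergy d m ξ)⁻¹ : ℝ) •
    ((rexp (-(2 * π * t * ⟪shellPoint d m ξ, η 1 - η 0⟫_ℝ)) : ℂ) *
      ((𝓕 F : 𝓢(SpaceTime d, ℂ)) (shellPoint d m ξ) *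
        (𝓕 G : 𝓢(SpaceTime d, ℂ)) (-shellPoint d m ξ))) with hΨ
  have hcongr : (fun t : ℝ => ∫ ξ, Ψ t ξ) =ᶠ[𝓝[>] 0] fun t : ℝ => ∫ x : Fin 2 → SpaceTime d,
      freeTwoPointWightmanHol d m
          (fun k => complexifyPoint (x k) + ((t : ℂ) * I) • complexifyPoint (η k)) *
        (F (x 0) * G (x 1)) := by
    filter_upwards [self_mem_nhdsWithin] with t ht
    exact (integral_freeTwoPointWightmanHol_ray_tensor hm F G hη ht).symm
  refine Tendsto.congr' hcongr ?_
  -- dominated convergence in the momentum integral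
  obtain ⟨CF, hCF0, hCF⟩ := SchwartzMap.exists_norm_le_one_add_pow_neg (𝓕 F : 𝓢(SpaceTime d, ℂ))
    (d + 1)
  obtain ⟨CG, hCG0, hCG⟩ := SchwartzMap.exists_norm_le_one_add_pow_neg (𝓕 G : 𝓢(SpaceTime d, ℂ)) 0
  have hcont : ∀ t : ℝ, Continuous (Ψ t) := by
    intro t
    have hE : Continuous fun ξ : EuclideanSpace ℝ (Fin d) => shellEnergy d m ξ :=
      continuous_shellEnergy m
    have hq : Continuous fun ξ : EuclideanSpace ℝ (Fin d) => shellPoint d m ξ := by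
      unfold shellPoint
      exact continuous_ofTimeSpace_uncurry.comp ((continuous_shellEnergy m).prodMk continuous_id)
    have hEpos : ∀ ξ : EuclideanSpace ℝ (Fin d), 4 * π * shellEnergy d m ξ ≠ 0 := fun ξ =>
      (mul_pos (by positivity) (shellEnergy_pos d hm ξ)).ne'
    simp only [hΨ]
    refine ((continuous_const.mul hE).inv₀ hEpos).smul ?_
    refine (Complex.continuous_ofReal.comp (Real.continuous_exp.comp ?_)).mul ?_
    · exact (continuous_const.mul (hq.inner continuous_const)).neg
    · exact ((𝓕 F : 𝓢(SpaceTime d, ℂ)).continuous.comp hq).mul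
        ((𝓕 G : 𝓢(SpaceTime d, ℂ)).continuous.comp hq.neg)
  set bound : EuclideanSpace ℝ (Fin d) → ℝ := fun ξ =>
    (4 * π * (|m| / (2 * π)))⁻¹ * (CF * CG) * (1 + ‖ξ‖) ^ (-((d : ℝ) + 1)) with hbound
  have hbound_int : Integrable bound := by
    have hJ : Integrable fun ξ : EuclideanSpace ℝ (Fin d) => (1 + ‖ξ‖) ^ (-((d : ℝ) + 1)) :=
      integrable_one_add_norm (by rw [finrank_euclideanSpace_fin]; linarith)
    exact hJ.const_mul ((4 * π * (|m| / (2 * π)))⁻¹ * (CF * CG))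
  have hle : ∀ᶠ t in 𝓝[>] (0 : ℝ), ∀ᵐ ξ ∂(volume : Measure (EuclideanSpace ℝ (Fin d))),
      ‖Ψ t ξ‖ ≤ bound ξ := by
    filter_upwards [self_mem_nhdsWithin] with t ht
    refine ae_of_all _ fun ξ => ?_
    have ht' : (0 : ℝ) < t := ht
    obtain ⟨hge, hδ⟩ := inner_shellPoint_ge hη m ξ
    have hE := shellEnergy_pos d hm ξ
    have hEm : |m| / (2 * π) ≤ shellEnergy d m ξ := by
      unfold shellEnergy
      calc |m| / (2 * π) = Real.sqrt ((m / (2 * π)) ^ 2) := by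
            rw [Real.sqrt_sq_eq_abs, abs_div, abs_of_pos (by positivity : (0 : ℝ) < 2 * π)]
        _ ≤ Real.sqrt (‖ξ‖ ^ 2 + (m / (2 * π)) ^ 2) := Real.sqrt_le_sqrt (by nlinarith)
    have hm' : 0 < |m| / (2 * π) := by positivity
    have hq : ‖ξ‖ ≤ ‖shellPoint d m ξ‖ := by
      have h2 : ‖ξ‖ ^ 2 ≤ ‖shellPoint d m ξ‖ ^ 2 := by
        rw [shellPoint, EuclideanSpace.real_norm_sq_eq, EuclideanSpace.real_norm_sq_eq,
          Fin.sum_univ_succ]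
        simp only [ofTimeSpace_apply_zero, ofTimeSpace_apply_succ]
        nlinarith [sq_nonneg (shellEnergy d m ξ)]
      exact (pow_le_pow_iff_left₀ (norm_nonneg _) (norm_nonneg _) two_ne_zero).1 h2
    have hinner0 : 0 ≤ ⟪shellPoint d m ξ, η 1 - η 0⟫_ℝ :=
      le_trans (mul_nonneg hδ.le (norm_nonneg _)) hge
    simp only [hΨ, hbound]
    rw [norm_smul, norm_mul, norm_mul, Complex.norm_real, Real.norm_of_nonneg (Real.exp_pos _).le,
      Real.norm_of_nonneg (by positivity)]
    have e1 : (4 * π * shellEnergy d m ξ)⁻¹ ≤ (4 * π * (|m| / (2 * π)))⁻¹ :=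
      inv_anti₀ (by positivity) (by nlinarith [Real.pi_pos])
    have e2 : rexp (-(2 * π * t * ⟪shellPoint d m ξ, η 1 - η 0⟫_ℝ)) ≤ 1 := by
      rw [Real.exp_le_one_iff]
      have : 0 ≤ 2 * π * t * ⟪shellPoint d m ξ, η 1 - η 0⟫_ℝ := by positivity
      linarith
    have e3 : ‖(𝓕 F : 𝓢(SpaceTime d, ℂ)) (shellPoint d m ξ)‖ ≤ CF * (1 + ‖ξ‖) ^ (-((d : ℝ) + 1)) := by
      refine (hCF _).trans ?_
      push_cast
      refine mul_le_mul_of_nonneg_left ?_ hCF0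
      exact Real.rpow_le_rpow_of_nonpos (by positivity) (by linarith) (by linarith)
    have e4 : ‖(𝓕 G : 𝓢(SpaceTime d, ℂ)) (-shellPoint d m ξ)‖ ≤ CG := by
      refine (hCG _).trans ?_
      simp
    calc (4 * π * shellEnergy d m ξ)⁻¹ * (rexp (-(2 * π * t * ⟪shellPoint d m ξ, η 1 - η 0⟫_ℝ)) *
          (‖(𝓕 F : 𝓢(SpaceTime d, ℂ)) (shellPoint d m ξ)‖ *
            ‖(𝓕 G : 𝓢(SpaceTime d, ℂ)) (-shellPoint d m ξ)‖))
        ≤ (4 * π * (|m| / (2 * π)))⁻¹ * (1 * ((CF * (1 + ‖ξ‖) ^ (-((d : ℝ) + 1))) * CG)) := by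
          gcongr
      _ = (4 * π * (|m| / (2 * π)))⁻¹ * (CF * CG) * (1 + ‖ξ‖) ^ (-((d : ℝ) + 1)) := by ring
  have hmeas : ∀ᶠ t in 𝓝[>] (0 : ℝ), AEStronglyMeasurable (Ψ t) volume :=
    Eventually.of_forall fun t => (hcont t).aestronglyMeasurable
  have hlim : ∀ᵐ ξ ∂(volume : Measure (EuclideanSpace ℝ (Fin d))),
      Tendsto (fun t => Ψ t ξ) (𝓝[>] 0) (𝓝 (Ψ 0 ξ)) := by
    refine ae_of_all _ fun ξ => ?_
    have hc : Continuous fun t : ℝ => Ψ t ξ := by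
      simp only [hΨ]
      fun_prop
    exact (hc.tendsto 0).mono_left nhdsWithin_le_nhds
  have key := tendsto_integral_filter_of_dominated_convergence bound hmeas hle hbound_int hlim
  have h0 : ∫ ξ, Ψ 0 ξ = freeTwoPoint d m F G := by
    rw [freeTwoPoint_def]
    congr 1
    funext ξ
    simp only [hΨ, mul_zero, zero_mul, neg_zero, Real.exp_zero, Complex.ofReal_one, one_mul]
  rw [h0] at key
  exact key

end Literature.Barriers.QuantumFields
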